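import Summits.BirchSwinnertonDyer.BirchSwinnertonDyer.Theorems.ManinLocalTwoThreeCDivisionIntegralCDT
import Summits.BirchSwinnertonDyer.BirchSwinnertonDyer.Theorems.EdixhovenFibreFiveSevenStarredOptimalManinUnitFiveSevenCdtThm1
import HarnessLib

set_option autoImplicit false
-- the sub-problem namespace `Summit.BirchSwinnertonDyer.BirchSwinnertonDyer` duplicates a component by design (D-0017)
set_option linter.dupNamespace false

/-!
# Route ManinLocalTwoThree, crux C3 `ManinPrimeToThreeAtNine` (stmt-BirchSwinnertonDyer-22968), closed by name

C3: granted the route's four printed-fact binders (Mazur 1978, Abbes–Ullmo 1996, Česnavičius 2018, modularity — all idle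
here), for every globally minimal `W/ℚ` and every lattice-optimal `X₀(N)`-datum `D` (`Λ_W = c · Λ_f`) at a level with
`9 ∣ N`: `3 ∤ c₀(D)`.

The landed conditional closer `ManinLocalTwoThree.CDivisionInt.maninPrimeToThreeAtNine_of_CDTInt` (cell bsd-f2-manin, p2:
`|c₀| = 1` at a level with an odd square factor, `CDivisionInt.abs_maninConstant_eq_one_of_CDTInt_of_odd_sq_dvd`, from
`Λ₁(f) ⊆ Λ_W` by the integer `c`-division chain) takes exactly the printed Calegari–Dimitrov–Tang Theorem 1.0.1 as
hypothesis; that hypothesis is now the tree theorem `calegariDimitrovTang2025_unboundedDenominators_holds` (p826028, line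
`cdt_thm1` of crux K★ of route EdixhovenFibreFiveSeven, cell bsd-wall: CDT Cor. 4.5.3 in invariant form proved for all
levels, Ihara amalgam + CSP, Prop. 3.0.1, (4.3.3), rationality).  Composing the two proves the item BY NAME.  (This file
necessarily imports the route-cone module carrying the integer chain; the `lint.theses-cone` warning is accepted.)

HONEST STATUS.  Manin's conjecture is NOT announced by this file: the route's deciding theorem still takes
`PrintedSemistableManinFacts` (four cite-only printed facts) and C2 `ManinOddAtFour` (22967, claimed by seat manin23-p1;
closable the same way through `maninLocalTwoThree_maninOddAtFour_of_CDT`).  BSD is not proved by this.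
[cite: CalegariDimitrovTang2025, Thm. 1.0.1] [cite: LingOesterle1991, Thm. 6]
-/

namespace Summit.BirchSwinnertonDyer.BirchSwinnertonDyer.Theorems

/-- **Crux C3 `ManinPrimeToThreeAtNine` (stmt-BirchSwinnertonDyer-22968), proved by name**: `3 ∤ c₀` at every
lattice-optimal `X₀(N)`-datum of a globally minimal curve when `9 ∣ N` — from CDT Theorem 1.0.1
(`calegariDimitrovTang2025_unboundedDenominators_holds`) through
`ManinLocalTwoThree.CDivisionInt.maninPrimeToThreeAtNine_of_CDTInt`; the four printed-fact binders are idle.  Manin's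
conjecture and BSD are NOT proved by this. [cite: CalegariDimitrovTang2025, Thm. 1.0.1] [cite: LingOesterle1991, Thm. 6] -/
theorem ManinLocalTwoThree.ManinPrimeToThreeAtNine_proof :
    Summit.BirchSwinnertonDyer.BirchSwinnertonDyer.Theses.ManinLocalTwoThree.ManinPrimeToThreeAtNine :=
  ManinLocalTwoThree.CDivisionInt.maninPrimeToThreeAtNine_of_CDTInt calegariDimitrovTang2025_unboundedDenominators_holds

end Summit.BirchSwinnertonDyer.BirchSwinnertonDyer.Theorems
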